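import Summits.ABC.ABC.Theorems.TowerFourSubLiouville.Negative.HallLangTransfer

/-!
# `TowerFourSubLiouville` (stmt-ABC-1649): even the part of the core `HallLang1728` that the composition USES —
# Hall–Lang on the dictionary ("trident-A") points — needs exponent `κ ≥ 6/5`

Negative-side calibration (standing disprover, cycle 9, refuter-cdisprove-stmt-ABC-1649-g9-0, 2026-08-17) for the picked line
`SketchIdeator5` (card `cm-hall-lang-transfer`, lead a1).  Its composition `stub_transfer ∘ stub_ulGivesUBQ ∘ stub_hallLangGivesUL`
applies the core `stub_hallLang1728` (`∀ N x y, y² = x³ + Nx ⟹ |x| ≤ C|N|^κ`) only to the images of coprime solutions of the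
quartic equation under the card's dictionary `SketchIdeator5.integralPoint_of_violator` / ideator 4's `trident_A`:

  `w Z⁴ = v Y⁴ + a  ⟹  (x, y) = (v w Y², v w² Y Z²)` lies on `y² = x³ + (a v w²)·x`.

`Negative.HallLangTransferPell` (p132424) pins the UNRESTRICTED core at `κ ≥ 2` with a Pell family that is NOT of this shape
(its `y` is not `v w² Y Z²`).  The obvious repair — restrict the core to dictionary points, i.e.

  `TridentHallLang κ := ∃ C > 0, ∀ a v w Y Z ≥ 1, gcd(vY, wZ) = 1 → w Z⁴ = v Y⁴ + a → v w Y² ≤ C (a v w²)^κ`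

(inlined below; no `def`) — is calibrated here: `not_tridentHallLang_of_lt_six_fifths`: FALSE for every `κ < 6/5`, by the
polynomial family (`w = a = 1`, parameter `r ≥ 1`)

  `Z = 40r⁷ + 140r⁶ + 252r⁵ + 280r⁴ + 210r³ + 105r² + 35r + 6`,  `Y = 2r² + 2r + 1`,
  `Z² + 1 = Y⁴ · c`,  `c = 100r⁶ + 300r⁵ + 485r⁴ + 470r³ + 309r² + 124r + 37`   (`tridentFamily_identity`, `ring`),

so that `Z⁴ = v·Y⁴ + 1` with `v = c (Z − 1)(Z + 1)` (`tridentFamily_equation`), `gcd(vY, Z) = 1` automatically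
(`Z² + 1 = Y⁴c`), and `x = v Y² ≍ r²⁴` against `N = v ≍ r²⁰`: Hall–Lang ratio `log x / log N → 6/5`.  (Construction: Hensel-lift
`s ↦ Z(s)` with `(s²+1)⁴ ∣ Z² + 1`, `deg Z = 7` — Mason–Stothers-extremal for `Z² + 1 = Y⁴c`, `deg Z = 3 deg Y + 1` — then
`s = 2r + 1` to make `Y = (s²+1)/2`, `Z/16`, `c/16` integral.)  The simpler family `Z = 1 + m⁴` (`Y⁴ ∣ Z − 1`) gives only `7/6`;
polynomial families are capped below `5/4` (`deg Y ≤ (deg Z − 1)/3`), and `5/4` is both the random-model threshold and the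
`ABC` ceiling for trident points (`ABC ⟹ Z³ ≲ avY`, `Y² ≲ a v^{1/4} w^{3/4}`, `x ≲ a v^{5/4} w^{7/4} ≤ (avw²)^{5/4}`), so the
restricted dial reads: false below `6/5` (this file), conjecturally false below `5/4`, `ABC`-true above `5/4` — again no
refutation of `∃ κ` short of `¬ABC`, and a restricted core would still have to be proved at (essentially) its conjectural
exponent.  What the crux needs from it: a `UBQ η`-violator (`a, v, w ≤ Z^η`) has `x ≥ Z^{2−η/2}/2` and `N ≤ Z^{4η}`, so
`TridentHallLang κ ⟹ UBQ η` for `η < 4/(8κ + 1)` (`≤ 4/11` at `κ = 5/4`).  No statement here is a Theses decl; nothing positive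
about the crux is asserted.
-/

-- `Summit.ABC.ABC` is the mandated summit-side namespace (CONVENTIONS §2); the duplicate is deliberate.
set_option linter.dupNamespace false

namespace Summit.ABC.ABC.Theorems.TowerFourSubLiouville.Negative

/-! ## The degree-7 family -/

/-- `Z² + 1 = Y⁴ · c` for the degree-7 family (over `ℕ`). -/
theorem tridentFamily_identity (r : ℕ) :
    (40 * r ^ 7 + 140 * r ^ 6 + 252 * r ^ 5 + 280 * r ^ 4 + 210 * r ^ 3 + 105 * r ^ 2 + 35 * r + 6) ^ 2 + 1 =
      (2 * r ^ 2 + 2 * r + 1) ^ 4 * (100 * r ^ 6 + 300 * r ^ 5 + 485 * r ^ 4 + 470 * r ^ 3 + 309 * r ^ 2 + 124 * r + 37) := by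
  ring

/-- The quartic equation `w Z⁴ = v Y⁴ + a` with `w = a = 1`, `v = c (Z − 1)(Z + 1)` (all factors written as polynomials with
nonnegative coefficients, so that everything lives in `ℕ`). -/
theorem tridentFamily_equation (r : ℕ) :
    1 * (40 * r ^ 7 + 140 * r ^ 6 + 252 * r ^ 5 + 280 * r ^ 4 + 210 * r ^ 3 + 105 * r ^ 2 + 35 * r + 6) ^ 4 =
      (100 * r ^ 6 + 300 * r ^ 5 + 485 * r ^ 4 + 470 * r ^ 3 + 309 * r ^ 2 + 124 * r + 37) *
          (40 * r ^ 7 + 140 * r ^ 6 + 252 * r ^ 5 + 280 * r ^ 4 + 210 * r ^ 3 + 105 * r ^ 2 + 35 * r + 5) *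
          (40 * r ^ 7 + 140 * r ^ 6 + 252 * r ^ 5 + 280 * r ^ 4 + 210 * r ^ 3 + 105 * r ^ 2 + 35 * r + 7) *
        (2 * r ^ 2 + 2 * r + 1) ^ 4 + 1 := by
  ring

/-- Worked member `r = 1`: `Z = 1068`, `Y = 5`, `c = 1825`, `1068² + 1 = 5⁴ · 1825`. -/
example : (1068 : ℕ) ^ 2 + 1 = 5 ^ 4 * 1825 ∧
    (40 + 140 + 252 + 280 + 210 + 105 + 35 + 6 : ℕ) = 1068 ∧ (100 + 300 + 485 + 470 + 309 + 124 + 37 : ℕ) = 1825 := by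
  norm_num

/-! ## Coprimality: `gcd(v·Y, w·Z) = 1` from `Z² + 1 = Y⁴ c`, `v = c (Z−1)(Z+1)` -/

/-- Abstract coprimality bookkeeping: if `Z² + 1 = Y⁴ c` and `Z = Zm + 1` then `gcd(c · Zm · (Z+1) · Y, Z) = 1`. -/
theorem trident_coprime {Z Y c Zm : ℕ} (h : Z ^ 2 + 1 = Y ^ 4 * c) (hZ : Z = Zm + 1) :
    Nat.Coprime (c * Zm * (Z + 1) * Y) (1 * Z) := by
  rw [one_mul]
  apply Nat.Coprime.symm
  have hYc : Nat.Coprime Z (Y ^ 4 * c) := by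
    rw [← h, show Z ^ 2 + 1 = 1 + Z * Z by ring]
    exact (Nat.coprime_add_mul_right_right Z 1 Z).mpr (Nat.coprime_one_right Z)
  have hc : Nat.Coprime Z c := Nat.Coprime.coprime_mul_left_right hYc
  have hY4 : Nat.Coprime Z (Y ^ 4) := Nat.Coprime.coprime_mul_right_right hYc
  have hY : Nat.Coprime Z Y := Nat.Coprime.coprime_dvd_right (dvd_pow_self Y (by norm_num)) hY4
  have hZp : Nat.Coprime Z (Z + 1) := by
    rw [show Z + 1 = 1 + Z by ring]
    exact (Nat.coprime_add_self_right).mpr (Nat.coprime_one_right Z)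
  have hZm : Nat.Coprime Z Zm := by
    rw [hZ, show Zm + 1 = 1 + Zm by ring]
    exact (Nat.coprime_add_self_left).mpr (Nat.coprime_one_left Zm)
  exact ((hc.mul_right hZm).mul_right hZp).mul_right hY

/-! ## Sizes (for `r ≥ 1`) -/

/-- `c ≤ 1825 r⁶`. -/
theorem trident_c_le {r : ℕ} (hr : 1 ≤ r) :
    100 * r ^ 6 + 300 * r ^ 5 + 485 * r ^ 4 + 470 * r ^ 3 + 309 * r ^ 2 + 124 * r + 37 ≤ 1825 * r ^ 6 := by
  have h1 : r ^ 5 ≤ r ^ 6 := Nat.pow_le_pow_right hr (by norm_num)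
  have h2 : r ^ 4 ≤ r ^ 6 := Nat.pow_le_pow_right hr (by norm_num)
  have h3 : r ^ 3 ≤ r ^ 6 := Nat.pow_le_pow_right hr (by norm_num)
  have h4 : r ^ 2 ≤ r ^ 6 := Nat.pow_le_pow_right hr (by norm_num)
  have h5 : r ≤ r ^ 6 := by simpa using Nat.pow_le_pow_right hr (show 1 ≤ 6 by norm_num)
  have h6 : 1 ≤ r ^ 6 := Nat.one_le_pow _ _ hr
  omega

/-- `Z − 1 ≤ 1067 r⁷`. -/
theorem trident_Zm_le {r : ℕ} (hr : 1 ≤ r) :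
    40 * r ^ 7 + 140 * r ^ 6 + 252 * r ^ 5 + 280 * r ^ 4 + 210 * r ^ 3 + 105 * r ^ 2 + 35 * r + 5 ≤ 1067 * r ^ 7 := by
  have h0 : r ^ 6 ≤ r ^ 7 := Nat.pow_le_pow_right hr (by norm_num)
  have h1 : r ^ 5 ≤ r ^ 7 := Nat.pow_le_pow_right hr (by norm_num)
  have h2 : r ^ 4 ≤ r ^ 7 := Nat.pow_le_pow_right hr (by norm_num)
  have h3 : r ^ 3 ≤ r ^ 7 := Nat.pow_le_pow_right hr (by norm_num)
  have h4 : r ^ 2 ≤ r ^ 7 := Nat.pow_le_pow_right hr (by norm_num)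
  have h5 : r ≤ r ^ 7 := by simpa using Nat.pow_le_pow_right hr (show 1 ≤ 7 by norm_num)
  have h6 : 1 ≤ r ^ 7 := Nat.one_le_pow _ _ hr
  omega

/-- `Z + 1 ≤ 1069 r⁷`. -/
theorem trident_Zp_le {r : ℕ} (hr : 1 ≤ r) :
    40 * r ^ 7 + 140 * r ^ 6 + 252 * r ^ 5 + 280 * r ^ 4 + 210 * r ^ 3 + 105 * r ^ 2 + 35 * r + 7 ≤ 1069 * r ^ 7 := by
  have := trident_Zm_le hr
  have h6 : 1 ≤ r ^ 7 := Nat.one_le_pow _ _ hr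
  omega

/-- `v = c (Z−1)(Z+1) ≤ 1825·1067·1069 · r²⁰`. -/
theorem trident_v_le {r : ℕ} (hr : 1 ≤ r) :
    (100 * r ^ 6 + 300 * r ^ 5 + 485 * r ^ 4 + 470 * r ^ 3 + 309 * r ^ 2 + 124 * r + 37) *
          (40 * r ^ 7 + 140 * r ^ 6 + 252 * r ^ 5 + 280 * r ^ 4 + 210 * r ^ 3 + 105 * r ^ 2 + 35 * r + 5) *
          (40 * r ^ 7 + 140 * r ^ 6 + 252 * r ^ 5 + 280 * r ^ 4 + 210 * r ^ 3 + 105 * r ^ 2 + 35 * r + 7) ≤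
      (1825 * 1067 * 1069) * r ^ 20 := by
  calc _ ≤ (1825 * r ^ 6) * (1067 * r ^ 7) * (1069 * r ^ 7) :=
        Nat.mul_le_mul (Nat.mul_le_mul (trident_c_le hr) (trident_Zm_le hr)) (trident_Zp_le hr)
    _ = (1825 * 1067 * 1069) * r ^ 20 := by ring

/-- `Y² ≥ r⁴`. -/
theorem trident_Y_sq_ge (r : ℕ) : r ^ 4 ≤ (2 * r ^ 2 + 2 * r + 1) ^ 2 := by
  have h : r ^ 2 ≤ 2 * r ^ 2 + 2 * r + 1 := by nlinarith
  calc r ^ 4 = (r ^ 2) ^ 2 := by ring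
    _ ≤ (2 * r ^ 2 + 2 * r + 1) ^ 2 := Nat.pow_le_pow_left h 2

/-- Real-exponent bookkeeping: `(r²⁰)^{s/5} = (r⁴)^s` for `r ≥ 0`. -/
theorem rpow_twenty_fifth {t : ℝ} (ht : 0 ≤ t) (s : ℝ) : (t ^ 20) ^ (s / 5) = (t ^ 4) ^ s := by
  rw [← Real.rpow_natCast t 20, ← Real.rpow_mul ht, ← Real.rpow_natCast t 4, ← Real.rpow_mul ht]
  congr 1
  push_cast
  ring

/-! ## Trident-restricted Hall–Lang needs `κ ≥ 6/5` -/

/-- **The dictionary-restricted core fails for every `κ < 6/5`.**  `x = v w Y²`, `N = a v w²` are the coordinates of the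
integral point `SketchIdeator5.integralPoint_of_violator` / `SketchIdeator4.trident_A` attached to a coprime solution of
`w Z⁴ = v Y⁴ + a`. -/
theorem not_tridentHallLang_of_lt_six_fifths (κ : ℝ) (hκ : κ < 6 / 5) :
    ¬ ∃ C : ℝ, 0 < C ∧ ∀ a v w Y Z : ℕ, 0 < a → 0 < v → 0 < w → 0 < Y → 0 < Z →
        Nat.Coprime (v * Y) (w * Z) → w * Z ^ 4 = v * Y ^ 4 + a →
        ((v * w * Y ^ 2 : ℕ) : ℝ) ≤ C * ((a * v * w ^ 2 : ℕ) : ℝ) ^ κ := by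
  rintro ⟨C, hC, h⟩
  -- exponent bookkeeping: `s := max (5(κ-1)) 0 ∈ [0, 1)`
  set s : ℝ := max (5 * (κ - 1)) 0 with hsdef
  have hs0 : 0 ≤ s := le_max_right _ _
  have hs1 : s < 1 := max_lt (by linarith) (by norm_num)
  have hκs : κ - 1 ≤ s / 5 := by
    have : 5 * (κ - 1) ≤ s := le_max_left _ _
    linarith
  set V : ℝ := (1825 * 1067 * 1069 : ℝ) with hVdef
  have hV : 1 ≤ V := by norm_num [hVdef]
  obtain ⟨M, -, hM⟩ := key_growth (K := 2 * C * V ^ (s / 5)) (by positivity) hs1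
  -- a parameter `r ≥ 1` with `r⁴ ≥ M`
  obtain ⟨r, hr⟩ := exists_nat_ge (max M 1)
  have hr1R : (1 : ℝ) ≤ (r : ℝ) := le_trans (le_max_right _ _) hr
  have hr1 : 1 ≤ r := by exact_mod_cast hr1R
  have hr0R : (0 : ℝ) ≤ (r : ℝ) := by linarith
  have hrM : M ≤ (r : ℝ) ^ 4 := by
    calc M ≤ (r : ℝ) := le_trans (le_max_left _ _) hr
      _ ≤ (r : ℝ) ^ 4 := by simpa using pow_le_pow_right₀ hr1R (show 1 ≤ 4 by norm_num)
  -- the witness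
  set Z : ℕ := 40 * r ^ 7 + 140 * r ^ 6 + 252 * r ^ 5 + 280 * r ^ 4 + 210 * r ^ 3 + 105 * r ^ 2 + 35 * r + 6 with hZdef
  set Zm : ℕ := 40 * r ^ 7 + 140 * r ^ 6 + 252 * r ^ 5 + 280 * r ^ 4 + 210 * r ^ 3 + 105 * r ^ 2 + 35 * r + 5 with hZmdef
  set Zp : ℕ := 40 * r ^ 7 + 140 * r ^ 6 + 252 * r ^ 5 + 280 * r ^ 4 + 210 * r ^ 3 + 105 * r ^ 2 + 35 * r + 7 with hZpdef
  set Y : ℕ := 2 * r ^ 2 + 2 * r + 1 with hYdef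
  set c : ℕ := 100 * r ^ 6 + 300 * r ^ 5 + 485 * r ^ 4 + 470 * r ^ 3 + 309 * r ^ 2 + 124 * r + 37 with hcdef
  have hZZm : Z = Zm + 1 := by simp [hZdef, hZmdef]
  have hZZp : Zp = Z + 1 := by simp [hZdef, hZpdef]
  have hid : Z ^ 2 + 1 = Y ^ 4 * c := tridentFamily_identity r
  have heq : 1 * Z ^ 4 = (c * Zm * Zp) * Y ^ 4 + 1 := tridentFamily_equation r
  have hcop : Nat.Coprime (c * Zm * Zp * Y) (1 * Z) := by rw [hZZp]; exact trident_coprime hid hZZm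
  have hvpos : 0 < c * Zm * Zp := by positivity
  have hYpos : 0 < Y := by positivity
  have hZpos : 0 < Z := by positivity
  have key := h 1 (c * Zm * Zp) 1 Y Z one_pos hvpos one_pos hYpos hZpos hcop heq
  -- rewrite the two sides: `x = v Y²`, `N = v`
  have hx : (((c * Zm * Zp) * 1 * Y ^ 2 : ℕ) : ℝ) = ((c * Zm * Zp : ℕ) : ℝ) * ((Y : ℕ) : ℝ) ^ 2 := by push_cast; ring
  have hN : ((1 * (c * Zm * Zp) * 1 ^ 2 : ℕ) : ℝ) = ((c * Zm * Zp : ℕ) : ℝ) := by push_cast; ring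
  rw [hx, hN] at key
  set v : ℝ := ((c * Zm * Zp : ℕ) : ℝ) with hvdef
  have hv0 : 0 < v := by rw [hvdef]; exact_mod_cast hvpos
  have hv1 : 1 ≤ v := by rw [hvdef]; exact_mod_cast hvpos
  have hvV : v ≤ V * (r : ℝ) ^ 20 := by
    rw [hvdef, hVdef]; exact_mod_cast trident_v_le hr1
  have hY2 : (r : ℝ) ^ 4 ≤ ((Y : ℕ) : ℝ) ^ 2 := by rw [hYdef]; exact_mod_cast trident_Y_sq_ge r
  -- from `v Y² ≤ C v^κ` get `Y² ≤ C v^{κ-1} ≤ C v^{s/5} ≤ C V^{s/5} (r⁴)^s ≤ r⁴/2 < r⁴ ≤ Y²`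
  have h1 : ((Y : ℕ) : ℝ) ^ 2 ≤ C * v ^ (κ - 1) := by
    rw [Real.rpow_sub_one hv0.ne', mul_div_assoc', le_div_iff₀ hv0]
    linarith [key]
  have h2 : v ^ (κ - 1) ≤ v ^ (s / 5) := Real.rpow_le_rpow_of_exponent_le hv1 hκs
  have h3 : v ^ (s / 5) ≤ (V * (r : ℝ) ^ 20) ^ (s / 5) := Real.rpow_le_rpow hv0.le hvV (by positivity)
  have h4 : (V * (r : ℝ) ^ 20) ^ (s / 5) = V ^ (s / 5) * ((r : ℝ) ^ 4) ^ s := by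
    rw [Real.mul_rpow (by positivity) (by positivity), rpow_twenty_fifth hr0R]
  have h5 := hM ((r : ℝ) ^ 4) hrM
  have hr4 : (0 : ℝ) < (r : ℝ) ^ 4 := by positivity
  have : ((Y : ℕ) : ℝ) ^ 2 < ((Y : ℕ) : ℝ) ^ 2 :=
    calc ((Y : ℕ) : ℝ) ^ 2 ≤ C * v ^ (κ - 1) := h1
      _ ≤ C * v ^ (s / 5) := mul_le_mul_of_nonneg_left h2 hC.le
      _ ≤ C * (V * (r : ℝ) ^ 20) ^ (s / 5) := mul_le_mul_of_nonneg_left h3 hC.le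
      _ = (2 * C * V ^ (s / 5) * ((r : ℝ) ^ 4) ^ s) / 2 := by rw [h4]; ring
      _ ≤ (r : ℝ) ^ 4 / 2 := by linarith
      _ < (r : ℝ) ^ 4 := by linarith
      _ ≤ ((Y : ℕ) : ℝ) ^ 2 := hY2
  exact lt_irrefl _ this

/-- … hence any witness `(κ, C)` of the dictionary-restricted core has `κ ≥ 6/5`. -/
theorem tridentHallLang_exponent_ge_six_fifths (κ C : ℝ) (hC : 0 < C)
    (h : ∀ a v w Y Z : ℕ, 0 < a → 0 < v → 0 < w → 0 < Y → 0 < Z →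
        Nat.Coprime (v * Y) (w * Z) → w * Z ^ 4 = v * Y ^ 4 + a →
        ((v * w * Y ^ 2 : ℕ) : ℝ) ≤ C * ((a * v * w ^ 2 : ℕ) : ℝ) ^ κ) : 6 / 5 ≤ κ := by
  by_contra hκ
  exact not_tridentHallLang_of_lt_six_fifths κ (not_le.mp hκ) ⟨C, hC, h⟩

/-- For comparison, the one-line family `Z = 1 + m⁴` (`Y⁴ ∣ Z − 1`; ratio `7/6` only): `Z⁴ = v m⁴ + 1` with
`v = (Z + 1)(Z² + 1)`. -/
example (m : ℤ) : (1 + m ^ 4) ^ 4 = ((1 + m ^ 4 + 1) * ((1 + m ^ 4) ^ 2 + 1)) * m ^ 4 + 1 := by ring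

end Summit.ABC.ABC.Theorems.TowerFourSubLiouville.Negative
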